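import Literature.Analysis.FluidPDE.DivFreeSobolevTesting
import HarnessLib

/-!
# Weakly divergence-free `L²_loc` fields tested against compactly supported `W^{1,2}` functions

Analysis/FluidPDE theorem file (no new definitions, everything PROVED): the `L²–L²` twin of
`Literature.Analysis.FluidPDE.IsWeaklyDivFree.integral_weakDeriv_apply_eq_zero`
(`DivFreeSobolevTesting.lean`, exponents `L³–L^{3/2}`).  If `b` is weakly divergence free with
`b ∈ L²(B(x₀, ρ + 2))`, and `W : ℝ³ → ℝ` has a weak derivative `GW ∈ L²` on the whole space with
`tsupport W ⊆ B(x₀, ρ)` and `GW = 0` off that ball, then `∫ GW(x)(b x) dx = 0` (Serrin 1963, §4;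
Evans, *PDE*, §5.3.1 Thm. 1: mollify `W`, `D(ρₙ ⋆ W) = ρₙ ⋆ GW → GW` in `L²`, Hölder against
`b ∈ L²` on the ball carrying all supports).  This is the form needed when the divergence-free field
is a VORTICITY `ω = curl v ∈ L²_loc` of a `W^{1,2}_loc` velocity (only square integrable), e.g. the
pairing `∫ ⟨ω, ∇(ψ⟨v, e⟩)⟩ = 0` in the weak vorticity equation.

* (private) `lintegral_enorm_apply_le_of_eq_zero_off_two` — `∫ ‖A(x)(b x)‖ ≤ ‖A‖_{L²} ‖1_B b‖_{L²}`;
* `IsWeaklyDivFree.integral_weakDeriv_apply_eq_zero_of_two` — the annihilation theorem.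

-- TODO(general form): conjugate exponents `p ∈ [1, ∞)`, `q = p'` (the proof is verbatim).

## References

* J. Serrin, in *Nonlinear Problems* (Madison 1962), Univ. Wisconsin Press 1963, §4. [`Serrin1963`]
* L. C. Evans, *Partial Differential Equations* (2010), §5.2.1, §5.3.1 Thm. 1. [`Evans2010`]
-/

noncomputable section

open MeasureTheory TopologicalSpace Set Function Filter InnerProductSpace Metric
open _root_.Topology
open scoped RealInnerProductSpace ENNReal NNReal ContDiff Convolution Pointwise

namespace Literature.Analysis.FluidPDE

section DivFreeTwo

variable {b : EuclideanSpace ℝ (Fin 3) → EuclideanSpace ℝ (Fin 3)} {W : EuclideanSpace ℝ (Fin 3) → ℝ}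
  {GW : EuclideanSpace ℝ (Fin 3) → EuclideanSpace ℝ (Fin 3) →L[ℝ] ℝ} {x₀ : EuclideanSpace ℝ (Fin 3)} {ρ : ℝ}

/-- **The Cauchy–Schwarz bound for the pairing of a covector field with a vector field on a set**:
`∫ ‖A(x)(b x)‖ ≤ ‖A‖_{L²} ‖1_S b‖_{L²}` when `A` vanishes off `S` (private Hölder helper). [folklore] -/
private theorem lintegral_enorm_apply_le_of_eq_zero_off_two {A : EuclideanSpace ℝ (Fin 3) → EuclideanSpace ℝ (Fin 3) →L[ℝ] ℝ}
    (hA : AEStronglyMeasurable A volume) (hb : AEStronglyMeasurable b volume) {S : Set (EuclideanSpace ℝ (Fin 3))}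
    (hS : MeasurableSet S) (hAS : ∀ x, x ∉ S → A x = 0) :
    ∫⁻ x, ‖A x (b x)‖ₑ ≤ eLpNorm A 2 volume * eLpNorm (S.indicator b) 2 volume := by
  have hpq : (2 : ℝ).HolderConjugate 2 := Real.holderConjugate_iff.2 ⟨by norm_num, by norm_num⟩
  have hbi : AEStronglyMeasurable (S.indicator b) volume := hb.indicator hS
  have h := ENNReal.lintegral_mul_le_Lp_mul_Lq volume hpq (f := fun x => ‖A x‖ₑ) (g := fun x => ‖S.indicator b x‖ₑ)
    hA.enorm hbi.enorm
  have hpt : ∀ x, ‖A x (b x)‖ₑ ≤ ‖A x‖ₑ * ‖S.indicator b x‖ₑ := by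
    intro x
    by_cases hx : x ∈ S
    · rw [indicator_of_mem hx]
      exact ContinuousLinearMap.le_opENorm _ _
    · rw [hAS x hx]
      simp
  have e1 : eLpNorm A 2 volume = (∫⁻ x, ‖A x‖ₑ ^ (2 : ℝ)) ^ (1 / (2 : ℝ)) := by
    rw [eLpNorm_eq_lintegral_rpow_enorm_toReal (by norm_num) ENNReal.ofNat_ne_top, ENNReal.toReal_ofNat]
  have e2 : eLpNorm (S.indicator b) 2 volume = (∫⁻ x, ‖S.indicator b x‖ₑ ^ (2 : ℝ)) ^ (1 / (2 : ℝ)) := by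
    rw [eLpNorm_eq_lintegral_rpow_enorm_toReal (by norm_num) ENNReal.ofNat_ne_top, ENNReal.toReal_ofNat]
  rw [e1, e2]
  calc ∫⁻ x, ‖A x (b x)‖ₑ ≤ ∫⁻ x, ‖A x‖ₑ * ‖S.indicator b x‖ₑ := lintegral_mono hpt
    _ ≤ _ := by simpa only [Pi.mul_apply] using h

/-- **A weakly divergence-free `L²_loc` field annihilates the weak gradient of a compactly supported
`W^{1,2}` function** (Serrin 1963, §4; the `L²–L²` twin of
`IsWeaklyDivFree.integral_weakDeriv_apply_eq_zero`).  Let `b` be weakly divergence free and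
measurable, `W : ℝ³ → ℝ` weakly differentiable on the whole space with `GW ∈ L²`,
`tsupport W ⊆ B(x₀, ρ)`, `GW = 0` off `B(x₀, ρ)`, and `b ∈ L²(B(x₀, ρ + 2))`.  Then
`∫ GW(x)(b x) dx = 0`.  Proof: the mollifications `Wₙ = ρₙ ⋆ W` are test functions supported in
`B(x₀, ρ + 2)`, `0 = ∫ ⟨b, ∇Wₙ⟩ = ∫ (ρₙ ⋆ GW)(b)`, and `∫ (ρₙ ⋆ GW − GW)(b) → 0` by Cauchy–Schwarz,
`‖ρₙ ⋆ GW − GW‖₂ → 0`. [cite: Serrin1963, §4; Evans2010 §5.3.1 Thm. 1] -/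
theorem IsWeaklyDivFree.integral_weakDeriv_apply_eq_zero_of_two (hdiv : IsWeaklyDivFree b)
    (hbm : AEStronglyMeasurable b volume) (hb2 : eLpNorm ((ball x₀ (ρ + 2)).indicator b) 2 volume < ⊤)
    (hW : FunctionSpaces.HasWeakFDerivOn (⊤ : Opens (EuclideanSpace ℝ (Fin 3))) volume W GW)
    (hGW : MemLp GW 2 volume) (hWρ : tsupport W ⊆ ball x₀ ρ)
    (hGWρ : ∀ x, x ∉ ball x₀ ρ → GW x = 0) :
    ∫ x, GW x (b x) = 0 := by
  have h12 : (1 : ℝ≥0∞) ≤ 2 := by norm_num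
  have hmeas : ∀ {A : EuclideanSpace ℝ (Fin 3) → EuclideanSpace ℝ (Fin 3) →L[ℝ] ℝ}, AEStronglyMeasurable A volume →
      AEStronglyMeasurable (fun x => A x (b x)) volume := fun hA =>
    (isBoundedBilinearMap_apply (𝕜 := ℝ) (E := EuclideanSpace ℝ (Fin 3)) (F := ℝ)).continuous.comp_aestronglyMeasurable
      (hA.prodMk hbm)
  obtain ⟨φ, hφr, -⟩ := FunctionSpaces.exists_contDiffBump_seq (E := EuclideanSpace ℝ (Fin 3))
  -- eventually the radii are `≤ 1`
  have hr1 : ∀ᶠ n in atTop, (φ n).rOut ≤ 1 := by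
    have := hφr.eventually (gt_mem_nhds one_pos)
    exact this.mono fun n hn => hn.le
  set S : Set (EuclideanSpace ℝ (Fin 3)) := ball x₀ (ρ + 2) with hS
  -- test functions and mollifications
  have hρT : ∀ n, FunctionSpaces.IsTestFunctionOn (⊤ : Opens (EuclideanSpace ℝ (Fin 3))) ((φ n).normed volume) := fun n =>
    FunctionSpaces.isTestFunctionOn_normed (φ n)
  set Wn : ℕ → EuclideanSpace ℝ (Fin 3) → ℝ := fun n => (φ n).normed volume ⋆[ContinuousLinearMap.lsmul ℝ ℝ, volume] W with hWn
  have hWcs : HasCompactSupport W := HasCompactSupport.of_support_subset_isCompact (isCompact_closedBall x₀ ρ)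
    ((subset_tsupport W).trans (hWρ.trans ball_subset_closedBall))
  have hWn_s : ∀ n, ContDiff ℝ ∞ (Wn n) := fun n => hW.contDiff_convolution (hρT n)
  have hWn_cs : ∀ n, HasCompactSupport (Wn n) := fun n => (φ n).hasCompactSupport_normed.convolution _ hWcs
  have hWn_T : ∀ n, FunctionSpaces.IsTestFunctionOn (⊤ : Opens (EuclideanSpace ℝ (Fin 3))) (Wn n) := fun n =>
    ⟨hWn_s n, hWn_cs n, by simp⟩
  -- divergence-freeness against `Wn n`
  have hzero : ∀ n, ∫ x, fderiv ℝ (Wn n) x (b x) = 0 := by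
    intro n
    have h := hdiv (Wn n) (hWn_T n)
    simp_rw [inner_gradient_eq_fderiv_apply] at h
    exact h
  -- `D(Wn n) = ρₙ ⋆ GW`
  set Gn : ℕ → EuclideanSpace ℝ (Fin 3) → EuclideanSpace ℝ (Fin 3) →L[ℝ] ℝ :=
    fun n => (φ n).normed volume ⋆[ContinuousLinearMap.lsmul ℝ ℝ, volume] GW with hGn
  have hDWn : ∀ n, fderiv ℝ (Wn n) = Gn n := fun n => funext fun x => (hW.hasFDerivAt_convolution (hρT n) x).fderiv
  -- `L²` convergence of `Gn n → GW`
  have hlim : Tendsto (fun n => eLpNorm (Gn n - GW) 2 volume) atTop (𝓝 0) :=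
    FunctionSpaces.tendsto_eLpNorm_normed_convolution_sub_self (μ := (volume : Measure (EuclideanSpace ℝ (Fin 3))))
      hφr h12 ENNReal.ofNat_ne_top hGW
  -- supports: `Gn n - GW` vanishes off `S` once `rOut ≤ 1`
  have hGnS : ∀ n, (φ n).rOut ≤ 1 → ∀ x, x ∉ S → (Gn n - GW) x = 0 := by
    intro n hn x hx
    have hGWρ' : tsupport GW ⊆ closedBall x₀ ρ := by
      refine closure_minimal (fun y hy => ?_) isClosed_closedBall
      by_contra h
      exact hy (hGWρ y fun h' => h (ball_subset_closedBall h'))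
    have hx1 : x ∉ closedBall (0 : EuclideanSpace ℝ (Fin 3)) 1 + tsupport GW := by
      rintro ⟨z, hz, y, hy, rfl⟩
      apply hx
      rw [hS, mem_ball, dist_eq_norm]
      have hy' := hGWρ' hy
      rw [mem_closedBall, dist_eq_norm] at hy'
      rw [mem_closedBall, dist_zero_right] at hz
      calc ‖z + y - x₀‖ = ‖z + (y - x₀)‖ := by abel_nf
        _ ≤ ‖z‖ + ‖y - x₀‖ := norm_add_le _ _
        _ < ρ + 2 := by linarith [show ‖z‖ ≤ 1 from hz]
    have h1 : Gn n x = 0 := FunctionSpaces.normed_convolution_eq_zero_of_not_mem (φ n) hn hx1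
    have h2 : GW x = 0 := hGWρ x fun h => hx (ball_subset_ball (by linarith) h)
    rw [Pi.sub_apply, h1, h2, sub_zero]
  -- the pairing `∫ (Gn n - GW)(b) → 0`
  have hGWm : AEStronglyMeasurable GW volume := hGW.1
  have hGnm : ∀ n, AEStronglyMeasurable (Gn n) volume := fun n => by
    rw [← hDWn n]
    exact ((hWn_s n).continuous_fderiv (by simp)).aestronglyMeasurable
  have hpair : Tendsto (fun n => ∫⁻ x, ‖(Gn n - GW) x (b x)‖ₑ) atTop (𝓝 0) := by
    have hbound : ∀ᶠ n in atTop, ∫⁻ x, ‖(Gn n - GW) x (b x)‖ₑ ≤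
        eLpNorm (Gn n - GW) 2 volume * eLpNorm (S.indicator b) 2 volume := by
      filter_upwards [hr1] with n hn
      exact lintegral_enorm_apply_le_of_eq_zero_off_two ((hGnm n).sub hGWm) hbm measurableSet_ball (hGnS n hn)
    have hlim' : Tendsto (fun n => eLpNorm (Gn n - GW) 2 volume * eLpNorm (S.indicator b) 2 volume)
        atTop (𝓝 0) := by
      have h := ENNReal.Tendsto.mul_const hlim (Or.inr hb2.ne)
      rwa [zero_mul] at h
    exact tendsto_of_tendsto_of_tendsto_of_le_of_le' tendsto_const_nhds hlim' (Eventually.of_forall fun _ => bot_le) hbound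
  -- integrability of the limit pairing and conclusion
  have hGWS : ∀ x, x ∉ S → GW x = 0 := fun x hx => hGWρ x fun h => hx (ball_subset_ball (by linarith) h)
  have hI : Integrable (fun x => GW x (b x)) volume := by
    refine ⟨?_, ?_⟩
    · exact hmeas hGWm
    · exact lt_of_le_of_lt (lintegral_enorm_apply_le_of_eq_zero_off_two hGWm hbm measurableSet_ball hGWS)
        (ENNReal.mul_lt_top hGW.eLpNorm_lt_top hb2)
  have hIn : ∀ n, (φ n).rOut ≤ 1 → Integrable (fun x => (Gn n - GW) x (b x)) volume := by
    intro n hn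
    refine ⟨?_, ?_⟩
    · exact hmeas ((hGnm n).sub hGWm)
    · have hfin : eLpNorm (Gn n - GW) 2 volume < ⊤ := by
        have hGn_p : MemLp (Gn n) 2 volume :=
          FunctionSpaces.memLp_normed_convolution (φ n) hGW h12
        exact (hGn_p.sub hGW).eLpNorm_lt_top
      exact lt_of_le_of_lt (lintegral_enorm_apply_le_of_eq_zero_off_two ((hGnm n).sub hGWm) hbm measurableSet_ball
        (hGnS n hn)) (ENNReal.mul_lt_top hfin hb2)
  -- `∫ GW(b) = ∫ Gn(b) - ∫ (Gn - GW)(b) = 0 - ∫ (Gn - GW)(b) → 0`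
  have hkey : ∀ᶠ n in atTop, ‖∫ x, GW x (b x)‖ₑ ≤ ∫⁻ x, ‖(Gn n - GW) x (b x)‖ₑ := by
    filter_upwards [hr1] with n hn
    have hsplit : ∫ x, GW x (b x) = (∫ x, Gn n x (b x)) - ∫ x, (Gn n - GW) x (b x) := by
      rw [← integral_sub (((hIn n hn).add hI).congr (Eventually.of_forall fun x => by
        simp only [Pi.add_apply, Pi.sub_apply, sub_apply]; ring)) (hIn n hn)]
      refine integral_congr_ae (Eventually.of_forall fun x => ?_)
      simp only [Pi.sub_apply, sub_apply]
      ring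
    have h0 : ∫ x, Gn n x (b x) = 0 := by rw [← hDWn n]; exact hzero n
    rw [hsplit, h0, zero_sub, enorm_neg]
    exact enorm_integral_le_lintegral_enorm _
  have hle : ‖∫ x, GW x (b x)‖ₑ ≤ 0 :=
    ge_of_tendsto hpair hkey
  simpa using hle

end DivFreeTwo

end Literature.Analysis.FluidPDE

end
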